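import Summits.HodgeConjecture.HodgeConjecture.Theorems.Ring2AbelianAllAndreSchollFormula
import Summits.HodgeConjecture.HodgeConjecture.Theorems.Ring2AbelianAllAndreFibreClass
import Literature.AlgebraicGeometry.HodgeTheory.PolarizationClassExistence
import HarnessLib

/-!
# Ring 2 · sub-cell AbelianAll (ALL ABELIAN VARIETIES), André axis, part XXXIX-e — THE KÜNNETH COMPONENTS OF THE DIAGONAL OF A COMPLEX ABELIAN
# VARIETY ARE ALGEBRAIC, EXPLICITLY: `π^i = ((-1)^i c)⁻¹ · (weight-i part of m^*θ^g)` — the standard conjecture `C(A)` with Scholl's projectors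

HONEST FRAMING (page 1, verbatim): **research route, not a corollary; conditional on HC_CM plus one named
minimal statement.** Cell line: research route conditional on HC_CM; not a corollary; Q11.4-sentence-2
already refuted in dim ≥ 3. Nothing in this file proves a case of the Hodge conjecture; `HC_CM` does not occur in this file. The result is
CLASSICAL in print (Lieberman–Kleiman: `B(A)`, hence `C(A)`; Deninger–Murre / Künnemann / Scholl: explicit projectors); the tree gains a
kernel proof on the Betti carriers with an explicit cycle formula.

Gen-31 file of the `ab-andre-2` seat (cell `pub-hodge-ring2`, sub-cell AbelianAll = ALL abelian varieties). By parts XXXIX-a/b, for a complex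
abelian variety `A` of dimension `g` with a polarisation `θ` and Mumford class `ℓ = m^*θ − pr₁^*θ − pr₂^*θ`: `m^*θ^g = Σ (g;j,e,n) pr₁^*θʲ ∪ ℓ^e ∪ pr₂^*θⁿ`,
the monomial `(j,e,n)` acts as zero on `H^{i'}(A)` unless `i' = 2j + e`, and `[m^*θ^g]_* = (-1)^i c` on `Hⁱ(A)` with one `c ≠ 0`. Hence the
weight-`i` part `W_i := Σ_{2j+e=i} (g;j,e,n) pr₁^*θʲ ∪ ℓ^e ∪ pr₂^*θⁿ` — an ALGEBRAIC class in `H^{2g}((A × A)(ℂ); ℂ)` — acts as `(-1)^i c` on `Hⁱ`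
and as `0` on every other `H^{i'}`: `π^i := ((-1)^i c)⁻¹ W_i` is the `i`-th Künneth projector. In print: [Milne 1999, proof of Thm. 5.10]
displays `p_i = (-1)^i/deg(λ_D) · Σ_j 1/(j!(g-i+j)!(i-2j)!) p^*[D^{g-i+j}] · q^*[Dʲ] · [M]^{i-2j}` with `Σ p_i = Δ_A` after [Scholl 1994, §5],
[Kunnemann1993], Deninger–Murre.

## What this file proves (sorry-free; no definition, no named fact)

* `monomial_mem_algebraicClasses` — `pr₁^*θʲ ∪ ℓ^e ∪ pr₂^*θⁿ ∈ N^{j+e+n} H^{2(j+e+n)}(A × A)` for a polarisation `θ`.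
* `corrAction_weightPart_eq` — `[W_i]_* x = [m^*θ^g]_* x` on `Hⁱ`, `corrAction_weightPart_eq_zero` — `[W_i]_* = 0` on `H^{i'}`, `i' ≠ i`.
* **`exists_algebraic_kunnethProjector`** — for every complex abelian variety `A` of dimension `k + 1` and every `i` there is an ALGEBRAIC class
  `P ∈ N^{k+1} H^{2(k+1)}((A × A)(ℂ); ℂ)` with `[P]_* x = x` on `Hⁱ(A(ℂ); ℂ)` and `[P]_* = 0` on `H^{i'}(A(ℂ); ℂ)` for `i' ≠ i` — the Künneth
  standard conjecture `C(A)` on the tree's carriers, with Scholl's explicit projector.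
* §2 **`exists_algebraic_kunnethDecomposition`** — ALGEBRAIC `P_0, …, P_{2g}` with these actions and `Σ_{i ≤ 2g} P_i = [Δ_A]` (the diagonal class
  `Δ_* 1`): Scholl's `p₀ + ⋯ + p_{2g} = Δ_A` in cohomology.

## Documentary interface — PRINT / LEAN / GAP

PRINT: [Kleiman1968AlgebraicCycles, §2 and App. 2A11] (`B(A)`, `B ⇒ C`); [Lieberman1968]; [Kunnemann1993, Thm. 3.1]; [Scholl1994ClassicalMotives, §5];
[Milne1999LefschetzClasses, proof of Thm. 5.10]. LEAN: the displayed theorems, fact-free; no rational-equivalence statement is claimed (cohomology only).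
GAP: none.
-/

noncomputable section

set_option linter.dupNamespace false

namespace Summit.HodgeConjecture.HodgeConjecture.Ring2.AbelianAll

open CategoryTheory CategoryTheory.Limits AlgebraicGeometry MonoidalCategory CartesianMonoidalCategory
open Literature.AlgebraicGeometry Literature.AlgebraicGeometry.Motives
open Literature.AlgebraicGeometry.HodgeTheory
open Literature.AlgebraicTopology.SingularHomology (singularCohomology cupProduct one_cupProduct)
open Literature.AlgebraicTopology.CharacteristicClasses (cupPow cupPow_zero cupPow_succ)
open Literature.NumberTheory.Automorphic.PicardCM (ratAlgebraicClasses mem_ratAlgebraicClasses_iff)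
open Summit.HodgeConjecture.CorCM.Model
open scoped MonObj

section Kunneth

variable (A : AbelianVariety ℂ)

/-- `Θ` — the complexification `θ ⊗ 1 ∈ H²(A(ℂ); ℂ)` of a rational degree-two class (display notation). -/
local notation3 (prettyPrint := false) "Θℂ[" A ", " θ "]" => ofRatClass (ComplexPoints (AbelianVariety.X A)) 2 θ
/-- `ℓ` — the complexified Poincaré (Mumford) class `(m^*θ − pr₁^*θ − pr₂^*θ) ⊗ 1 ∈ H²((A × A)(ℂ); ℂ)` (display notation). -/
local notation3 (prettyPrint := false) "ℓℂ[" A ", " θ "]" => ofRatClass (ComplexPoints (AbelianVariety.X A ⊗ AbelianVariety.X A)) 2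
  (BettiUniverse.pull μ[AbelianVariety.X A] 2 θ - BettiUniverse.pull (fst (AbelianVariety.X A) (AbelianVariety.X A)) 2 θ -
    BettiUniverse.pull (snd (AbelianVariety.X A) (AbelianVariety.X A)) 2 θ)

/-- **The monomials `pr₁^*θʲ ∪ (ℓ^e ∪ pr₂^*θⁿ)` are algebraic** when `θ ⊗ 1` is a polarisation (pull-backs, powers and cup products of the
algebraic classes `θ` and `ℓ`). [cite: VoisinHodgeII2003, §9.2.4 Prop. 9.20–9.21] [cite: MumfordAV1970, §6 Cor. 3] -/
theorem monomial_mem_algebraicClasses {k : ℕ} (hA : IsSmoothProjective (k + 1) A.X) (θ : bettiCohomology A.X 2)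
    (hθpol : IsPolarizationClass (k + 1) A.X Θℂ[A, θ]) (j e n : ℕ) {m mm : ℕ} (hm : e + n = m) (hmm : j + m = mm)
    (h₂ : 2 * e + 2 * n = 2 * m) (h₁ : 2 * j + 2 * m = 2 * mm) :
    cupProduct h₁ (cupPow ℂ (complexBetti.map (fst A.X A.X) 2 Θℂ[A, θ]) j)
        (cupProduct h₂ (cupPow ℂ ℓℂ[A, θ] e) (cupPow ℂ (complexBetti.map (snd A.X A.X) 2 Θℂ[A, θ]) n)) ∈
      algebraicClasses (A.X ⊗ A.X) mm := by
  have hAA := IsSmoothProjective.tensor_holds hA hA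
  have hθalg : Θℂ[A, θ] ∈ algebraicClasses A.X 1 := hθpol.mem_algebraicClasses
  have hθrat : θ ∈ ratAlgebraicClasses A.X 1 := by rw [mem_ratAlgebraicClasses_iff]; exact hθalg
  have hℓalg : ℓℂ[A, θ] ∈ algebraicClasses (A.X ⊗ A.X) 1 := by
    have h := polClass_mem_ratAlgebraicClasses A hθrat
    rwa [mem_ratAlgebraicClasses_iff] at h
  have hfst : complexBetti.map (fst A.X A.X) 2 Θℂ[A, θ] ∈ algebraicClasses (A.X ⊗ A.X) 1 :=
    map_mem_algebraicClasses_of_isAlgebraicCorrespondence hAA hA (p := 1) (q := 1)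
      (isAlgebraicCorrespondence_map hAA hA (fst A.X A.X) (by omega)) hθalg
  have hsnd : complexBetti.map (snd A.X A.X) 2 Θℂ[A, θ] ∈ algebraicClasses (A.X ⊗ A.X) 1 :=
    map_mem_algebraicClasses_of_isAlgebraicCorrespondence hAA hA (p := 1) (q := 1)
      (isAlgebraicCorrespondence_map hAA hA (snd A.X A.X) (by omega)) hθalg
  exact cupProduct_mem_algebraicClasses_of_add hAA h₁ hmm (cupPow_mem_algebraicClasses hAA hfst j)
    (cupProduct_mem_algebraicClasses_of_add hAA h₂ hm (cupPow_mem_algebraicClasses hAA hℓalg e) (cupPow_mem_algebraicClasses hAA hsnd n))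

/-- **THE KÜNNETH COMPONENTS OF THE DIAGONAL OF A COMPLEX ABELIAN VARIETY ARE ALGEBRAIC (Scholl's projectors).** For a complex abelian
variety `A` of dimension `k + 1` and every degree `i` there is an ALGEBRAIC class `P ∈ N^{k+1} H^{2(k+1)}((A × A)(ℂ); ℂ)` whose correspondence
action is the `i`-th Künneth projector: `[P]_* x = x` for `x ∈ Hⁱ(A(ℂ); ℂ)` and `[P]_* x = 0` for `x ∈ H^{i'}(A(ℂ); ℂ)`, `i' ≠ i`. Explicitly
`P = ((-1)^i c)⁻¹ Σ_{2j+e=i} (g; j,e,n) pr₁^*θʲ ∪ ℓ^e ∪ pr₂^*θⁿ` for any polarisation `θ` (`ℓ` its Mumford class, `c ≠ 0` the constant of part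
XXXIX-a) — the weight-`i` part of `m^*θ^g`, which acts as `[m^*θ^g]_* = (-1)^i c` on `Hⁱ` and as zero elsewhere (selection rule of part XXXIX-b).
The standard conjecture `C(A)` on the tree's Betti carriers. [cite: Kleiman1968AlgebraicCycles, §2 and App. to §2, 2A11] [cite: Scholl1994ClassicalMotives, §5]
[cite: Milne1999LefschetzClasses, proof of Thm. 5.10] [cite: Kunnemann1993, Thm. 3.1] -/
theorem exists_algebraic_kunnethProjector {k : ℕ} (hA : IsSmoothProjective (k + 1) A.X) (hdim : A.dim = k + 1) (i : ℕ) :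
    ∃ P ∈ algebraicClasses (A.X ⊗ A.X) (k + 1),
      (∀ x : complexBetti A.X i, corrAction complexOrientationFamily hA hA (rfl : i + 2 * (k + 1) = i + 2 * (k + 1)) P x = x) ∧
      ∀ i' : ℕ, i' ≠ i → ∀ x : complexBetti A.X i',
        corrAction complexOrientationFamily hA hA (rfl : i' + 2 * (k + 1) = i' + 2 * (k + 1)) P x = 0 := by
  -- a polarisation `θ ⊗ 1`
  obtain ⟨ηA, hη⟩ := exists_isPolarizationClass hA
  obtain ⟨θ, hθ⟩ := (isRationalClass_iff_mem_range_ofRatClass ηA).1 hη.isRationalClass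
  subst hθ
  have hAA := IsSmoothProjective.tensor_holds hA hA
  -- the constant `c` of `[m^*θ^g]_*` and `c ≠ 0` (part XXXIX-b's block theorem at `b = 0`... read on `H¹` directly)
  obtain ⟨c, hc⟩ := exists_corrAction_pullMul_top_eq_smul A hA (cupPow ℂ Θℂ[A, θ] (k + 1))
  have hc0 : c ≠ 0 := by
    obtain ⟨θ', ℓ', c₁, hθ', hℓ', -, hc₁, hinv⟩ := exists_polarClass_inverts_lefschetz A (k := k) hdim.symm hA hη
    obtain rfl : θ = θ' := ofRatClass_injective _ hθ'.symm
    subst hℓ'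
    obtain ⟨x, hx⟩ : ∃ x : complexBetti A.X 1, x ≠ 0 := by
      haveI := (abelianVarietyCohomologyExteriorH1_holds A).1
      exact (Module.finrank_pos_iff_exists_ne_zero (R := ℂ)).1
        (by rw [(abelianVarietyCohomologyExteriorH1_holds A).2.1, hdim]; omega)
    have h1 : ((-1 : ℂ) ^ 1 * c) • x = ((((k + 1).choose 0 : ℕ) : ℂ) * (((k + 1 - 0).choose (1 - 2 * 0) : ℕ) : ℂ)) •
        cupProduct (show 2 * 0 + 1 = 1 by norm_num) (cupPow ℂ Θℂ[A, θ] 0)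
          (corrAction complexOrientationFamily hA hA (show 1 + 2 * k + 2 * 0 + 2 * 1 = 1 + 2 * (k + 1) by omega)
            (cupPow ℂ ℓℂ[A, θ] 1)
            (cupProduct (rfl : 1 + 2 * k + 2 * 0 = 1 + 2 * k + 2 * 0)
              (cupProduct (rfl : 1 + 2 * k = 1 + 2 * k) x (cupPow ℂ Θℂ[A, θ] k)) (cupPow ℂ Θℂ[A, θ] 0))) := by
      rw [← hc 1 x, corrAction_pullMul_cupPow_eq_sum A hA θ (M := 0) (by norm_num) (show 1 + k = k + 1 by omega) x,
        Fin.sum_univ_one]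
      rfl
    rw [cupPow_zero, cupPow_one_eq,
      corrAction_cupProduct_one complexOrientationFamily hA (show 1 + 2 * k + 0 = 1 + 2 * k + 2 * 0 from rfl) _
        (show 1 + 2 * k + 2 * 1 = 1 + 2 * (k + 1) by omega),
      hinv x, show ∀ V : complexBetti A.X 1, cupProduct (show 2 * 0 + 1 = 1 by norm_num) (singularCohomology.one ℂ (ComplexPoints A.X)) V = V
        from fun V ↦ one_cupProduct V, smul_smul] at h1
    intro hc'
    rw [hc', mul_zero, zero_smul, eq_comm, smul_eq_zero] at h1
    refine hc₁ ?_
    rcases h1 with h1 | h1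
    · simp only [Nat.choose_zero_right, Nat.sub_zero, Nat.mul_zero, Nat.choose_one_right, Nat.cast_one, one_mul, mul_eq_zero,
        Nat.cast_eq_zero, Nat.succ_ne_zero, false_or] at h1
      exact h1
    · exact absurd h1 hx
  -- the weight-`i` part of `m^*θ^g`
  set W : complexBetti (A.X ⊗ A.X) (2 * (k + 1)) :=
    ∑ j : Fin (k + 1 + 1), ((k + 1).choose j : ℂ) • ∑ e : Fin (k + 1 - j + 1),
      (if 2 * (j : ℕ) + e = i then (((k + 1 - j).choose e : ℕ) : ℂ) else 0) •
        cupProduct (two_mul_val_add_two_mul_sub j) (cupPow ℂ (complexBetti.map (fst A.X A.X) 2 Θℂ[A, θ]) j)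
          (cupProduct (two_mul_val_add_two_mul_sub e) (cupPow ℂ ℓℂ[A, θ] e)
            (cupPow ℂ (complexBetti.map (snd A.X A.X) 2 Θℂ[A, θ]) (k + 1 - j - e))) with hW
  have hWalg : W ∈ algebraicClasses (A.X ⊗ A.X) (k + 1) := by
    refine Submodule.sum_mem _ fun j _ ↦ Submodule.smul_mem _ _ (Submodule.sum_mem _ fun e _ ↦ Submodule.smul_mem _ _ ?_)
    exact monomial_mem_algebraicClasses A hA θ hη _ _ _ (by have := e.2; omega) (by have := j.2; omega) _ _
  -- its action in degree `i'`
  have hact : ∀ (i' : ℕ) (x : complexBetti A.X i'),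
      corrAction complexOrientationFamily hA hA (rfl : i' + 2 * (k + 1) = i' + 2 * (k + 1)) W x =
        ∑ j : Fin (k + 1 + 1), ((k + 1).choose j : ℂ) • ∑ e : Fin (k + 1 - j + 1),
          (if 2 * (j : ℕ) + e = i then (((k + 1 - j).choose e : ℕ) : ℂ) else 0) •
            corrAction complexOrientationFamily hA hA (rfl : i' + 2 * (k + 1) = i' + 2 * (k + 1))
              (cupProduct (two_mul_val_add_two_mul_sub j) (cupPow ℂ (complexBetti.map (fst A.X A.X) 2 Θℂ[A, θ]) j)
                (cupProduct (two_mul_val_add_two_mul_sub e) (cupPow ℂ ℓℂ[A, θ] e)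
                  (cupPow ℂ (complexBetti.map (snd A.X A.X) 2 Θℂ[A, θ]) (k + 1 - j - e)))) x := by
    intro i' x
    rw [hW, map_sum, LinearMap.sum_apply]
    refine Finset.sum_congr rfl fun j _ ↦ ?_
    rw [map_smul, LinearMap.smul_apply, map_sum, LinearMap.sum_apply]
    refine congrArg _ (Finset.sum_congr rfl fun e _ ↦ ?_)
    rw [map_smul, LinearMap.smul_apply]
  -- the full expansion of `[m^*θ^g]_*`
  have hfull : ∀ (i' : ℕ) (x : complexBetti A.X i'),
      corrAction complexOrientationFamily hA hA (rfl : i' + 2 * (k + 1) = i' + 2 * (k + 1))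
          (complexBetti.map μ[A.X] (2 * (k + 1)) (cupPow ℂ Θℂ[A, θ] (k + 1))) x =
        ∑ j : Fin (k + 1 + 1), ((k + 1).choose j : ℂ) • ∑ e : Fin (k + 1 - j + 1), (((k + 1 - j).choose e : ℕ) : ℂ) •
            corrAction complexOrientationFamily hA hA (rfl : i' + 2 * (k + 1) = i' + 2 * (k + 1))
              (cupProduct (two_mul_val_add_two_mul_sub j) (cupPow ℂ (complexBetti.map (fst A.X A.X) 2 Θℂ[A, θ]) j)
                (cupProduct (two_mul_val_add_two_mul_sub e) (cupPow ℂ ℓℂ[A, θ] e)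
                  (cupPow ℂ (complexBetti.map (snd A.X A.X) 2 Θℂ[A, θ]) (k + 1 - j - e)))) x := by
    intro i' x
    rw [complexBetti_map_cupPow, map_mul_ofRatClass_two_eq, cupPow_add_eq_sum_choose, map_sum, LinearMap.sum_apply]
    refine Finset.sum_congr rfl fun j _ ↦ ?_
    rw [map_smul, LinearMap.smul_apply, corrAction_fst_cupPow_add_eq_sum]
  refine ⟨(((-1 : ℂ) ^ i * c)⁻¹) • W, Submodule.smul_mem _ _ hWalg, fun x ↦ ?_, fun i' hi' x ↦ ?_⟩
  · -- on `Hⁱ`: `[W]_* x = [m^*θ^g]_* x = (-1)^i c x`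
    have hne : (-1 : ℂ) ^ i * c ≠ 0 := mul_ne_zero (pow_ne_zero i (neg_ne_zero.2 one_ne_zero)) hc0
    rw [map_smul, LinearMap.smul_apply, hact]
    conv_rhs => rw [← inv_smul_smul₀ hne x, ← hc i x, hfull]
    congr 1
    refine Finset.sum_congr rfl fun j _ ↦ congrArg _ (Finset.sum_congr rfl fun e _ ↦ ?_)
    split_ifs with h
    · rfl
    · rw [zero_smul, corrAction_monomial_eq_zero_of_ne A hA θ _ _ _ _ _ (fun h' ↦ h h'.symm) x, smul_zero]
  · -- on `H^{i'}`, `i' ≠ i`: every surviving monomial has weight `i ≠ i'`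
    rw [map_smul, LinearMap.smul_apply, hact, smul_eq_zero]
    refine Or.inr (Finset.sum_eq_zero fun j _ ↦ ?_)
    rw [smul_eq_zero]
    refine Or.inr (Finset.sum_eq_zero fun e _ ↦ ?_)
    split_ifs with h
    · rw [corrAction_monomial_eq_zero_of_ne A hA θ _ _ _ _ _ (show i' ≠ 2 * (j : ℕ) + e by omega) x, smul_zero]
    · rw [zero_smul]

end Kunneth

/-! ## §2 The Künneth decomposition of the diagonal class is algebraic: `Σ_i π^i = [Δ_A]` -/

section Diagonal

variable (A : AbelianVariety ℂ)

/-- **`p₀ + p₁ + ⋯ + p_{2g} = Δ_A` IN COHOMOLOGY, WITH ALGEBRAIC `p_i`.** For a complex abelian variety `A` of dimension `g = k + 1` there are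
ALGEBRAIC classes `P_0, …, P_{2g} ∈ N^g H^{2g}((A × A)(ℂ); ℂ)` such that `[P_i]_*` is the `i`-th Künneth projector (identity on `Hⁱ`, zero on
`H^{i'}`, `i' ≠ i`) and `Σ_{i ≤ 2g} P_i = [Δ_A] := Δ_* 1` — the diagonal class DECOMPOSES into algebraic Künneth components (§1 for each `i`; the sum
and `[Δ_A]` both act as the identity in every degree `≤ 2g`, part XXXVII-g₁'s `corrAction_diagonal_one`, and a degree-`0` correspondence class is
determined by its action, ring2-b05's `eq_zero_of_forall_corrAction_eq_zero`). In print: [Milne 1999, proof of Thm. 5.10] «`p₀ + p₁ + ⋯ + p_{2g} = Δ_A`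
(Scholl 1994, Section 5) … for every Weil cohomology theory, `cl(p_i)` is the `i`th Künneth component of the diagonal» (there in `CH^g(A × A)_ℚ`;
here its image in cohomology). [cite: Milne1999LefschetzClasses, proof of Thm. 5.10] [cite: Scholl1994ClassicalMotives, §5] [cite: Kunnemann1993, Thm. 3.1]
[cite: Fulton1998, §16.1] -/
theorem exists_algebraic_kunnethDecomposition {k : ℕ} (hA : IsSmoothProjective (k + 1) A.X) (hdim : A.dim = k + 1) :
    ∃ P : ℕ → complexBetti (A.X ⊗ A.X) (2 * (k + 1)),
      (∀ i, P i ∈ algebraicClasses (A.X ⊗ A.X) (k + 1)) ∧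
      (∀ i, ∀ x : complexBetti A.X i, corrAction complexOrientationFamily hA hA (rfl : i + 2 * (k + 1) = i + 2 * (k + 1)) (P i) x = x) ∧
      (∀ i i' : ℕ, i' ≠ i → ∀ x : complexBetti A.X i',
        corrAction complexOrientationFamily hA hA (rfl : i' + 2 * (k + 1) = i' + 2 * (k + 1)) (P i) x = 0) ∧
      ∑ i ∈ Finset.range (2 * (k + 1) + 1), P i =
        complexGysin complexOrientationFamily hA (IsSmoothProjective.tensor_holds hA hA) (lift (𝟙 A.X) (𝟙 A.X))
          (show 0 + 2 * (k + 1 + (k + 1)) = 2 * (k + 1) + 2 * (k + 1) by ring) (singularCohomology.one ℂ (ComplexPoints A.X)) := by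
  choose P hPalg hPid hPzero using fun i ↦ exists_algebraic_kunnethProjector A hA hdim i
  refine ⟨P, hPalg, hPid, hPzero, ?_⟩
  rw [← sub_eq_zero]
  refine Theorems.eq_zero_of_forall_corrAction_eq_zero complexOrientationFamily hA fun a ha ↦ LinearMap.ext fun x ↦ ?_
  rw [map_sub, LinearMap.sub_apply, LinearMap.zero_apply, corrAction_diagonal_one complexOrientationFamily hA _ x, map_sum,
    LinearMap.sum_apply, Finset.sum_eq_single a (fun i _ hi ↦ hPzero i a (Ne.symm hi) x)
      (fun h ↦ absurd (Finset.mem_range.2 (by omega)) h), hPid a x, sub_self]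

end Diagonal

end Summit.HodgeConjecture.HodgeConjecture.Ring2.AbelianAll

end
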